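/-
Origin: written from primary sources — S. Kudla, *Seesaw dual reductive pairs* (1984) §1 (see-saw identity of theta
integrals); A. Weil, Acta Math. 111 (1964) Chap. III n° 41 Thm 6 / Lemme 5 pp. 193–194 (majorants, invariance of `Θ` under
rational points); S. Gelbart, J. Rogawski, Invent. Math. 105 (1991) §3.1 Remark p. 457, §3.2 (the theta kernel of a unitary
dual pair). Adapted: no. This file packages the renormalised small pairs of `UnitaryDualPairSeesawThetaProduct` as theta-KERNEL
DATA (`Weil1964.ThetaKernelDatum.adelicOfDualPairRep`) and instantiates the abstract see-saw identity for theta lifts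
(`Weil1964.ThetaLiftSeesawProduct`) at the splitting data of record. Kernel only; no records.
-/
import Literature.NumberTheory.GelbartRogawski1991.UnitaryDualPairSeesawThetaProduct
import Literature.NumberTheory.Weil1964.ThetaLiftSeesawProduct
import Literature.NumberTheory.Weil1964.AdelicMetaplecticScalarTwist
import HarnessLib

/-!
# (eq:seesaw) at the splitting data of record: the torus period of the big theta kernel is the product of the
# two renormalised small theta lifts

Continuation of `UnitaryDualPairSeesawThetaProduct` (kernel level) and `Weil1964/ThetaLiftSeesawProduct` (abstract lift
level).  For the three compatible splittings `s, s₁, s₂` of record ([GelbartRogawski1991, Prop. 3.1.1] instances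
`IsCompatible`) and the renormalised small representations `ω₁′ = seesawRep₁`, `ω₂′ = seesawRep₂` (scheme small):

* §1 `Θ`-invariance at rational points of `ω_j′` (`seesawRep₁/₂_toHomUnits_mem_thetaStabilizer`: the see-saw characters are
  `1` there and `ω ∘ pairSmall_j s_j` fixes `Θ` [Weil1964, Thm 6]); hence **the theta-KERNEL DATA of the renormalised small
  pairs** `seesawDatum₁/₂ := adelicOfDualPairRep (ω_j′) …` over `U(J_V)(𝔸) × U(J_j)(𝔸)` with rational lattices (majorants of
  `ω_j′` and the `U(J_j)`-stable index sets are hypotheses, as for the big pair's `thetaKernelDatum`; for the `(12)` torus the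
  majorants follow from those of `ω ∘ pairSmall_j s_j` and continuity of the pair splittings, `hasThetaMajorants_seesawRep₁/₂`);
* §2 **`isSeesawProduct_seesawTensor`** — the big pair's `thetaKernelDatum` and the two `seesawDatum_j` satisfy
  `IsSeesawProduct` along `u₁ ⊕ᶠ u₂` for the pure tensor `Φ₁ ⊗ Φ₂ = seesawTensor Φ₁ Φ₂` (this is §1 of
  `UnitaryDualPairSeesawThetaProduct`); rational block-diagonal points are rational (`blockDiag_mem_range`); and therefore
  **`seesawPeriod_eq_thetaLift_mul`**: for finite measures `μ₁, μ₂` on the compact quotients `[U(J₁)]`, `[U(J₂)]` and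
  `f_j ∈ C([U(J_j)])`,
  `∫_{[U(J₁)]×[U(J₂)]} θ_{Φ₁ ⊗ Φ₂}(ξ, u₁ ⊕ᶠ u₂) f₁(u₁) f₂(u₂) d(μ₁ ⊗ μ₂) = Θ′¹_{Φ₁}(f₁)(ξ) · Θ′²_{Φ₂}(f₂)(ξ)`
  — PerL v5 (eq:seesaw) (tex ll. 323–325) for the CONSTRUCTED objects — and its WEDGE form `seesawPeriod_wedge_eq_det`
  (the global wedge-function of (eq:Qaut), tex l. 249, as ONE torus period);
* §3 the conjugated `(34)` torus: `seesawConjDatum₁/₂` (majorant HYPOTHESES named `hM₃`, `hM₄` — not derived, no continuity of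
  `λ_V′` being claimed for a general conjugator), `isSeesawProduct_seesawConjTensor` along `u ↦ g (u₁ ⊕ᶠ u₂) g⁻¹`,
  `seesawConjPeriod_eq_thetaLift_mul` («the same holds for type (34) with T′», tex l. 326).

Provenance / use (Hodge-CM model-construction cell, rows `gen12`/`real34`): PKG consumer `Gen12FunBridge.wf_gen` of
`HodgeCM/Model/Binders/MeetBridges.lean` — with `wf :=` the product (resp. wedge) of the components of two theta one-forms
and the pins `W.ρ = ω ∘ pairSplitting s`, `(S.P k).ω = seesawRep_j` (CONTRACT of BINDER-TRIAGE §33/§39), `wf_gen` is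
`seesawPeriod_wedge_eq_det` read through the model's currency conversions.  Nothing here is a claim of the manuscripts under
adjudication.
-/

set_option autoImplicit false

noncomputable section

open scoped Matrix Kronecker
open _root_.MeasureTheory NumberField
open Literature.RepresentationTheory Literature.RepresentationTheory.SeesawScalar
open Literature.RepresentationTheory.HeisenbergGroup
open Literature.NumberTheory.Automorphic
open Literature.NumberTheory.Automorphic.UnitaryGroup
open Literature.NumberTheory.Weil1964
open Literature.NumberTheory.Weil1964.ThetaKernelDatum

namespace Literature.NumberTheory.GelbartRogawski1991

namespace UnitaryDualPair

/-! ## §1–§2 The `(12)` torus -/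

section Twelve

variable (F E : Type) [Field F] [NumberField F] [Field E] [NumberField E] [Algebra F E]
variable (c : E ≃ₐ[F] E) (N M₁ M₂ : ℕ) {n n₁ n₂ : ℕ}
  (eW : Fin N × Fin (M₁ + M₂) ≃ Fin n) (e₁ : Fin N × Fin M₁ ≃ Fin n₁) (e₂ : Fin N × Fin M₂ ≃ Fin n₂)
variable (JV : Matrix (Fin N) (Fin N) E) (J₁ : Matrix (Fin M₁) (Fin M₁) E) (J₂ : Matrix (Fin M₂) (Fin M₂) E)
variable {TV : Matrix (Fin N) (Fin N) F} {T₁ : Matrix (Fin M₁) (Fin M₁) F} {T₂ : Matrix (Fin M₂) (Fin M₂) F}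
variable [Algebra.IsQuadraticExtension F E] {δ : E} (hcδ : c δ = -δ) (hδ : δ ≠ 0) {d : F}
  (hd : δ * δ = algebraMap F E d) (hV : TV.IsSymm) (h₁ : T₁.IsSymm) (h₂ : T₂.IsSymm) (hVd : IsUnit TV.det)
  (h₁d : IsUnit T₁.det) (h₂d : IsUnit T₂.det) (hWd : IsUnit (finSum M₁ M₂ T₁ T₂).det)
  (hJV : JV = TV.map (algebraMap F E)) (hJ₁ : J₁ = T₁.map (algebraMap F E)) (hJ₂ : J₂ = T₂.map (algebraMap F E))
  {s : adelicPair F E c N (M₁ + M₂) JV (finSum M₁ M₂ J₁ J₂) →*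
    adelicMpCont F (Fin n) (adelicGram F eW TV (finSum M₁ M₂ T₁ T₂))}
  {s₁ : adelicPair F E c N M₁ JV J₁ →* adelicMpCont F (Fin n₁) (adelicGram F e₁ TV T₁)}
  {s₂ : adelicPair F E c N M₂ JV J₂ →* adelicMpCont F (Fin n₂) (adelicGram F e₂ TV T₂)}
  (hs : (splittingDatum F E c N (M₁ + M₂) eW JV (finSum M₁ M₂ J₁ J₂) hcδ hδ hd hV (isSymm_finSum h₁ h₂) hVd hWd hJV
    (finSum_eq_map_finSum F E M₁ M₂ J₁ J₂ hJ₁ hJ₂)).IsCompatible s)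
  (hs₁ : (splittingDatum F E c N M₁ e₁ JV J₁ hcδ hδ hd hV h₁ hVd h₁d hJV hJ₁).IsCompatible s₁)
  (hs₂ : (splittingDatum F E c N M₂ e₂ JV J₂ hcδ hδ hd hV h₂ hVd h₂d hJV hJ₂).IsCompatible s₂)

/-! ### §1 `Θ`-invariance of the renormalised small representations at rational points; their kernel data -/

/-- the see-saw character of the first small pair is `1` at rational points: `λ_V γ_U · λ₁ γ = 1`.
[cite: Weil1964, Chap. III n° 41 Thm 6 p. 193] -/
theorem seesawChar₁_eq_one_of_rational {γU : adelic F E c N JV} (hγU : γU ∈ (toAdelic F E c N JV).range)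
    {γ : adelic F E c M₁ J₁} (hγ : γ ∈ (toAdelic F E c M₁ J₁).range) :
    mpCharSmall₁ (seesawBigSum F E c N M₁ M₂ eW JV J₁ J₂ s) (pairSmall₁ F E c N M₁ e₁ JV J₁ s₁)
        (pairSmall₂ F E c N M₂ e₂ JV J₂ s₂)
        (hs₃_seesaw F E c N M₁ M₂ eW e₁ e₂ JV J₁ J₂ hcδ hδ hd hV h₁ h₂ hVd h₁d h₂d hWd hJV hJ₁ hJ₂ hs hs₁ hs₂)
        (isUnit_kronecker_map F N hVd h₁d) (isUnit_kronecker_map F N hVd h₂d) (γU, γ) = 1 := by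
  have hcV : charV₁₂ F E c N M₁ M₂ eW e₁ e₂ JV J₁ J₂ hcδ hδ hd hV h₁ h₂ hVd h₁d h₂d hWd hJV hJ₁ hJ₂ hs hs₁ hs₂ γU = 1 := charV₁₂_eq_one_of_rational F E c N M₁ M₂ eW e₁ e₂ JV J₁ J₂ hcδ hδ hd hV h₁ h₂ hVd h₁d h₂d hWd hJV hJ₁ hJ₂ hs hs₁ hs₂ hγU
  have hc1 : char₁ F E c N M₁ M₂ eW e₁ e₂ JV J₁ J₂ hcδ hδ hd hV h₁ h₂ hVd h₁d h₂d hWd hJV hJ₁ hJ₂ hs hs₁ hs₂ γ = 1 := char₁_eq_one_of_rational F E c N M₁ M₂ eW e₁ e₂ JV J₁ J₂ hcδ hδ hd hV h₁ h₂ hVd h₁d h₂d hWd hJV hJ₁ hJ₂ hs hs₁ hs₂ hγ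
  refine (mpCharSmall₁_apply_eq_mul _ _ _ _ _ _ γU γ).trans ?_
  exact (congrArg₂ (· * ·) hcV hc1).trans (mul_one 1)

/-- the see-saw character of the second small pair is `1` at rational points: `λ₂ γ = 1`.
[cite: Weil1964, Chap. III n° 41 Thm 6 p. 193] -/
theorem seesawChar₂_eq_one_of_rational (γU : adelic F E c N JV)
    {γ : adelic F E c M₂ J₂} (hγ : γ ∈ (toAdelic F E c M₂ J₂).range) :
    mpCharSmall₂ (seesawBigSum F E c N M₁ M₂ eW JV J₁ J₂ s) (pairSmall₁ F E c N M₁ e₁ JV J₁ s₁)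
        (pairSmall₂ F E c N M₂ e₂ JV J₂ s₂)
        (hs₃_seesaw F E c N M₁ M₂ eW e₁ e₂ JV J₁ J₂ hcδ hδ hd hV h₁ h₂ hVd h₁d h₂d hWd hJV hJ₁ hJ₂ hs hs₁ hs₂)
        (isUnit_kronecker_map F N hVd h₁d) (isUnit_kronecker_map F N hVd h₂d) (γU, γ) = 1 :=
  (mpCharSmall₂_apply _ _ _ _ _ _ γU γ).trans (char₂_eq_one_of_rational F E c N M₁ M₂ eW e₁ e₂ JV J₁ J₂ hcδ hδ hd hV h₁ h₂ hVd h₁d h₂d hWd hJV hJ₁ hJ₂ hs hs₁ hs₂ hγ)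

/-- **`ω₁′(γ_U, γ)` fixes `Θ`** for `γ_U ∈ U(J_V)(F)`, `γ ∈ U(J₁)(F)`. [cite: Weil1964, Chap. III n° 41 Thm 6 p. 193] -/
theorem seesawRep₁_toHomUnits_mem_thetaStabilizer {γU : adelic F E c N JV} (hγU : γU ∈ (toAdelic F E c N JV).range)
    {γ : adelic F E c M₁ J₁} (hγ : γ ∈ (toAdelic F E c M₁ J₁).range) :
    (seesawRep₁ F E c N M₁ M₂ eW e₁ e₂ JV J₁ J₂ hcδ hδ hd hV h₁ h₂ hVd h₁d h₂d hWd hJV hJ₁ hJ₂ hs hs₁ hs₂).toHomUnits (γU, γ) ∈ thetaStabilizer F (Fin N × Fin M₁) :=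
  (toHomUnits_mem_thetaStabilizer_iff _ _).2 fun Φ =>
    (congrArg (thetaDistLM F (Fin N × Fin M₁))
        (LinearMap.congr_fun (SeesawScalar.twist_apply_of_eq_one _
          (seesawChar₁_eq_one_of_rational F E c N M₁ M₂ eW e₁ e₂ JV J₁ J₂ hcδ hδ hd hV h₁ h₂ hVd h₁d h₂d hWd hJV hJ₁ hJ₂ hs hs₁ hs₂ hγU hγ)) Φ)).trans
      (thetaDistLM_omega_of_mem_adelicMpTheta
        (coe_pairSmall₁_mem_adelicMpTheta F E c N M₁ e₁ JV J₁ hcδ hδ hd hV h₁ hVd h₁d hJV hJ₁ hs₁ hγU hγ) Φ)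

/-- **`ω₂′(γ_U, γ)` fixes `Θ`** for `γ_U ∈ U(J_V)(F)`, `γ ∈ U(J₂)(F)`. [cite: Weil1964, Chap. III n° 41 Thm 6 p. 193] -/
theorem seesawRep₂_toHomUnits_mem_thetaStabilizer {γU : adelic F E c N JV} (hγU : γU ∈ (toAdelic F E c N JV).range)
    {γ : adelic F E c M₂ J₂} (hγ : γ ∈ (toAdelic F E c M₂ J₂).range) :
    (seesawRep₂ F E c N M₁ M₂ eW e₁ e₂ JV J₁ J₂ hcδ hδ hd hV h₁ h₂ hVd h₁d h₂d hWd hJV hJ₁ hJ₂ hs hs₁ hs₂).toHomUnits (γU, γ) ∈ thetaStabilizer F (Fin N × Fin M₂) :=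
  (toHomUnits_mem_thetaStabilizer_iff _ _).2 fun Φ =>
    (congrArg (thetaDistLM F (Fin N × Fin M₂))
        (LinearMap.congr_fun (SeesawScalar.twist_apply_of_eq_one _
          (seesawChar₂_eq_one_of_rational F E c N M₁ M₂ eW e₁ e₂ JV J₁ J₂ hcδ hδ hd hV h₁ h₂ hVd h₁d h₂d hWd hJV hJ₁ hJ₂ hs hs₁ hs₂ γU hγ)) Φ)).trans
      (thetaDistLM_omega_of_mem_adelicMpTheta
        (coe_pairSmall₂_mem_adelicMpTheta F E c N M₂ e₂ JV J₂ hcδ hδ hd hV h₂ hVd h₂d hJV hJ₂ hs₂ hγU hγ) Φ)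

/-- **majorants of `ω₁′`** from majorants of `ω ∘ pairSmall₁ s₁` and the continuity of the three pair splittings (the
see-saw character `λ_V λ₁` is then continuous, `UnitaryDualPairSeesawSchemeSmall`). [cite: Weil1964, Chap. III n° 41 Lemme 5 p. 194] -/
theorem hasThetaMajorants_seesawRep₁
    (hρ₁ : HasThetaMajorants fun (p : adelic F E c N JV × adelic F E c M₁ J₁) (Φ : piSchwartzBruhat F (Fin N × Fin M₁)) =>
      (adelicMpCont.omega F (Fin N × Fin M₁)
              (TV.map (algebraMap F (AdeleRing (𝓞 F) F)) ⊗ₖ T₁.map (algebraMap F (AdeleRing (𝓞 F) F)))) (pairSmall₁ F E c N M₁ e₁ JV J₁ s₁ p) Φ)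
    (hc : Continuous (pairSplitting F E c N (M₁ + M₂) eW JV (finSum M₁ M₂ J₁ J₂) s))
    (hc₁ : Continuous (pairSplitting F E c N M₁ e₁ JV J₁ s₁))
    (hc₂ : Continuous (pairSplitting F E c N M₂ e₂ JV J₂ s₂)) :
    HasThetaMajorants fun (p : adelic F E c N JV × adelic F E c M₁ J₁) (Φ : piSchwartzBruhat F (Fin N × Fin M₁)) =>
      seesawRep₁ F E c N M₁ M₂ eW e₁ e₂ JV J₁ J₂ hcδ hδ hd hV h₁ h₂ hVd h₁d h₂d hWd hJV hJ₁ hJ₂ hs hs₁ hs₂ p Φ := by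
  have hcont : Continuous fun p : adelic F E c N JV × adelic F E c M₁ J₁ =>
      ((charV₁₂ F E c N M₁ M₂ eW e₁ e₂ JV J₁ J₂ hcδ hδ hd hV h₁ h₂ hVd h₁d h₂d hWd hJV hJ₁ hJ₂ hs hs₁ hs₂ p.1 * char₁ F E c N M₁ M₂ eW e₁ e₂ JV J₁ J₂ hcδ hδ hd hV h₁ h₂ hVd h₁d h₂d hWd hJV hJ₁ hJ₂ hs hs₁ hs₂ p.2 : ℂˣ) : ℂ) := by
    simp only [Units.val_mul]
    exact ((continuous_charV₁₂ F E c N M₁ M₂ eW e₁ e₂ JV J₁ J₂ hcδ hδ hd hV h₁ h₂ hVd h₁d h₂d hWd hJV hJ₁ hJ₂ hs hs₁ hs₂ hc hc₁ hc₂).comp continuous_fst).mul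
      ((continuous_char₁ F E c N M₁ M₂ eW e₁ e₂ JV J₁ J₂ hcδ hδ hd hV h₁ h₂ hVd h₁d h₂d hWd hJV hJ₁ hJ₂ hs hs₁ hs₂ hc hc₁ hc₂).comp continuous_snd)
  have hmaj := hρ₁.smul hcont
  refine ⟨fun Φ ξ => ?_, fun Φ g₀ => ?_⟩
  · have h := hmaj.continuous_eval Φ ξ
    refine h.congr fun p => ?_
    exact congrArg (fun Ψ : piSchwartzBruhat F (Fin N × Fin M₁) => (Ψ : (Fin N × Fin M₁ → AdeleRing (𝓞 F) F) → ℂ)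
      (ratPt F (Fin N × Fin M₁) ξ)) (seesawRep₁_apply F E c N M₁ M₂ eW e₁ e₂ JV J₁ J₂ hcδ hδ hd hV h₁ h₂ hVd h₁d h₂d hWd hJV hJ₁ hJ₂ hs hs₁ hs₂ p.1 p.2 Φ).symm
  · obtain ⟨V, hVn, u, hu, hle⟩ := hmaj.exists_majorant Φ g₀
    refine ⟨V, hVn, u, hu, fun ξ p hp => ?_⟩
    rw [seesawRep₁_apply F E c N M₁ M₂ eW e₁ e₂ JV J₁ J₂ hcδ hδ hd hV h₁ h₂ hVd h₁d h₂d hWd hJV hJ₁ hJ₂ hs hs₁ hs₂ p.1 p.2 Φ]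
    exact hle ξ p hp

/-- **majorants of `ω₂′`** from majorants of `ω ∘ pairSmall₂ s₂` and continuity of the splittings.
[cite: Weil1964, Chap. III n° 41 Lemme 5 p. 194] -/
theorem hasThetaMajorants_seesawRep₂
    (hρ₂ : HasThetaMajorants fun (p : adelic F E c N JV × adelic F E c M₂ J₂) (Φ : piSchwartzBruhat F (Fin N × Fin M₂)) =>
      (adelicMpCont.omega F (Fin N × Fin M₂)
              (TV.map (algebraMap F (AdeleRing (𝓞 F) F)) ⊗ₖ T₂.map (algebraMap F (AdeleRing (𝓞 F) F)))) (pairSmall₂ F E c N M₂ e₂ JV J₂ s₂ p) Φ)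
    (hc : Continuous (pairSplitting F E c N (M₁ + M₂) eW JV (finSum M₁ M₂ J₁ J₂) s))
    (hc₁ : Continuous (pairSplitting F E c N M₁ e₁ JV J₁ s₁))
    (hc₂ : Continuous (pairSplitting F E c N M₂ e₂ JV J₂ s₂)) :
    HasThetaMajorants fun (p : adelic F E c N JV × adelic F E c M₂ J₂) (Φ : piSchwartzBruhat F (Fin N × Fin M₂)) =>
      seesawRep₂ F E c N M₁ M₂ eW e₁ e₂ JV J₁ J₂ hcδ hδ hd hV h₁ h₂ hVd h₁d h₂d hWd hJV hJ₁ hJ₂ hs hs₁ hs₂ p Φ := by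
  have hcont : Continuous fun p : adelic F E c N JV × adelic F E c M₂ J₂ => ((char₂ F E c N M₁ M₂ eW e₁ e₂ JV J₁ J₂ hcδ hδ hd hV h₁ h₂ hVd h₁d h₂d hWd hJV hJ₁ hJ₂ hs hs₁ hs₂ p.2 : ℂˣ) : ℂ) :=
    (continuous_char₂ F E c N M₁ M₂ eW e₁ e₂ JV J₁ J₂ hcδ hδ hd hV h₁ h₂ hVd h₁d h₂d hWd hJV hJ₁ hJ₂ hs hs₁ hs₂ hc hc₁ hc₂).comp continuous_snd
  have hmaj := hρ₂.smul hcont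
  refine ⟨fun Φ ξ => ?_, fun Φ g₀ => ?_⟩
  · have h := hmaj.continuous_eval Φ ξ
    refine h.congr fun p => ?_
    exact congrArg (fun Ψ : piSchwartzBruhat F (Fin N × Fin M₂) => (Ψ : (Fin N × Fin M₂ → AdeleRing (𝓞 F) F) → ℂ)
      (ratPt F (Fin N × Fin M₂) ξ)) (seesawRep₂_apply F E c N M₁ M₂ eW e₁ e₂ JV J₁ J₂ hcδ hδ hd hV h₁ h₂ hVd h₁d h₂d hWd hJV hJ₁ hJ₂ hs hs₁ hs₂ p.1 p.2 Φ).symm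
  · obtain ⟨V, hVn, u, hu, hle⟩ := hmaj.exists_majorant Φ g₀
    refine ⟨V, hVn, u, hu, fun ξ p hp => ?_⟩
    rw [seesawRep₂_apply F E c N M₁ M₂ eW e₁ e₂ JV J₁ J₂ hcδ hδ hd hV h₁ h₂ hVd h₁d h₂d hWd hJV hJ₁ hJ₂ hs hs₁ hs₂ p.1 p.2 Φ]
    exact hle ξ p hp

variable [LocallyCompactSpace (adelic F E c N JV)] [LocallyCompactSpace (adelic F E c M₁ J₁)]
  [LocallyCompactSpace (adelic F E c M₂ J₂)] [LocallyCompactSpace (adelic F E c (M₁ + M₂) (finSum M₁ M₂ J₁ J₂))]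

/-- **THE THETA-KERNEL DATUM OF THE FIRST RENORMALISED SMALL PAIR `(U(J_V), U(J₁))`** (Weil's `adelicOfDualPairRep` at
`ω₁′`; carriers `U(J_V)(𝔸) × U(J₁)(𝔸)`, rational lattices, kernel `θ′_{Φ₁}(x, u) = Θ(ω₁′(x⁻¹, u⁻¹) Φ₁)`; hypotheses:
majorants of `ω₁′` and an `U(J₁)(𝔸)`-stable index set). [cite: Weil1964, Chap. III n° 41 Thm 6 p. 193] -/
def seesawDatum₁
    (hρ₁ : HasThetaMajorants fun (p : adelic F E c N JV × adelic F E c M₁ J₁) (Φ : piSchwartzBruhat F (Fin N × Fin M₁)) =>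
      seesawRep₁ F E c N M₁ M₂ eW e₁ e₂ JV J₁ J₂ hcδ hδ hd hV h₁ h₂ hVd h₁d h₂d hWd hJV hJ₁ hJ₂ hs hs₁ hs₂ p Φ)
    (SK₁ : Set (piSchwartzBruhat F (Fin N × Fin M₁)))
    (hSK₁ : ∀ (h : adelic F E c M₁ J₁) (Φ : piSchwartzBruhat F (Fin N × Fin M₁)), Φ ∈ SK₁ →
      seesawRep₁ F E c N M₁ M₂ eW e₁ e₂ JV J₁ J₂ hcδ hδ hd hV h₁ h₂ hVd h₁d h₂d hWd hJV hJ₁ hJ₂ hs hs₁ hs₂ (1, h) Φ ∈ SK₁) :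
    ThetaKernelDatum (adelic F E c N JV × adelic F E c M₁ J₁)
      (repWeilThetaDatum F (Fin N × Fin M₁) (seesawRep₁ F E c N M₁ M₂ eW e₁ e₂ JV J₁ J₂ hcδ hδ hd hV h₁ h₂ hVd h₁d h₂d hWd hJV hJ₁ hJ₂ hs hs₁ hs₂).toHomUnits
        ((((toAdelic F E c N JV).range).prod (toAdelic F E c M₁ J₁).range :
            Subgroup (adelic F E c N JV × adelic F E c M₁ J₁)) :
          Set (adelic F E c N JV × adelic F E c M₁ J₁))).ThetaTop
      (adelic F E c N JV) (toAdelic F E c N JV).range (adelic F E c M₁ J₁) (toAdelic F E c M₁ J₁).range :=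
  ThetaKernelDatum.adelicOfDualPairRep (ΓU := (toAdelic F E c N JV).range) (Γ := (toAdelic F E c M₁ J₁).range)
    (seesawRep₁ F E c N M₁ M₂ eW e₁ e₂ JV J₁ J₂ hcδ hδ hd hV h₁ h₂ hVd h₁d h₂d hWd hJV hJ₁ hJ₂ hs hs₁ hs₂) hρ₁
    (fun _ hγU _ hγ => seesawRep₁_toHomUnits_mem_thetaStabilizer F E c N M₁ M₂ eW e₁ e₂ JV J₁ J₂ hcδ hδ hd hV h₁ h₂ hVd h₁d h₂d hWd hJV hJ₁ hJ₂ hs hs₁ hs₂ hγU hγ) SK₁ hSK₁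

/-- **THE THETA-KERNEL DATUM OF THE SECOND RENORMALISED SMALL PAIR `(U(J_V), U(J₂))`.**
[cite: Weil1964, Chap. III n° 41 Thm 6 p. 193] -/
def seesawDatum₂
    (hρ₂ : HasThetaMajorants fun (p : adelic F E c N JV × adelic F E c M₂ J₂) (Φ : piSchwartzBruhat F (Fin N × Fin M₂)) =>
      seesawRep₂ F E c N M₁ M₂ eW e₁ e₂ JV J₁ J₂ hcδ hδ hd hV h₁ h₂ hVd h₁d h₂d hWd hJV hJ₁ hJ₂ hs hs₁ hs₂ p Φ)
    (SK₂ : Set (piSchwartzBruhat F (Fin N × Fin M₂)))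
    (hSK₂ : ∀ (h : adelic F E c M₂ J₂) (Φ : piSchwartzBruhat F (Fin N × Fin M₂)), Φ ∈ SK₂ →
      seesawRep₂ F E c N M₁ M₂ eW e₁ e₂ JV J₁ J₂ hcδ hδ hd hV h₁ h₂ hVd h₁d h₂d hWd hJV hJ₁ hJ₂ hs hs₁ hs₂ (1, h) Φ ∈ SK₂) :
    ThetaKernelDatum (adelic F E c N JV × adelic F E c M₂ J₂)
      (repWeilThetaDatum F (Fin N × Fin M₂) (seesawRep₂ F E c N M₁ M₂ eW e₁ e₂ JV J₁ J₂ hcδ hδ hd hV h₁ h₂ hVd h₁d h₂d hWd hJV hJ₁ hJ₂ hs hs₁ hs₂).toHomUnits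
        ((((toAdelic F E c N JV).range).prod (toAdelic F E c M₂ J₂).range :
            Subgroup (adelic F E c N JV × adelic F E c M₂ J₂)) :
          Set (adelic F E c N JV × adelic F E c M₂ J₂))).ThetaTop
      (adelic F E c N JV) (toAdelic F E c N JV).range (adelic F E c M₂ J₂) (toAdelic F E c M₂ J₂).range :=
  ThetaKernelDatum.adelicOfDualPairRep (ΓU := (toAdelic F E c N JV).range) (Γ := (toAdelic F E c M₂ J₂).range)
    (seesawRep₂ F E c N M₁ M₂ eW e₁ e₂ JV J₁ J₂ hcδ hδ hd hV h₁ h₂ hVd h₁d h₂d hWd hJV hJ₁ hJ₂ hs hs₁ hs₂) hρ₂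
    (fun _ hγU _ hγ => seesawRep₂_toHomUnits_mem_thetaStabilizer F E c N M₁ M₂ eW e₁ e₂ JV J₁ J₂ hcδ hδ hd hV h₁ h₂ hVd h₁d h₂d hWd hJV hJ₁ hJ₂ hs hs₁ hs₂ hγU hγ) SK₂ hSK₂

variable
  (hρ : HasThetaMajorants fun (p : adelic F E c N JV × adelic F E c (M₁ + M₂) (finSum M₁ M₂ J₁ J₂))
    (Φ : piSchwartzBruhat F (Fin n)) => pairRep F E c N (M₁ + M₂) eW JV (finSum M₁ M₂ J₁ J₂) s p Φ)
  (SK : Set (piSchwartzBruhat F (Fin n)))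
  (hSK : ∀ (h : adelic F E c (M₁ + M₂) (finSum M₁ M₂ J₁ J₂)) (Φ : piSchwartzBruhat F (Fin n)), Φ ∈ SK →
    pairRep F E c N (M₁ + M₂) eW JV (finSum M₁ M₂ J₁ J₂) s (1, h) Φ ∈ SK)
  (hρ₁ : HasThetaMajorants fun (p : adelic F E c N JV × adelic F E c M₁ J₁) (Φ : piSchwartzBruhat F (Fin N × Fin M₁)) =>
    seesawRep₁ F E c N M₁ M₂ eW e₁ e₂ JV J₁ J₂ hcδ hδ hd hV h₁ h₂ hVd h₁d h₂d hWd hJV hJ₁ hJ₂ hs hs₁ hs₂ p Φ)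
  (SK₁ : Set (piSchwartzBruhat F (Fin N × Fin M₁)))
  (hSK₁ : ∀ (h : adelic F E c M₁ J₁) (Φ : piSchwartzBruhat F (Fin N × Fin M₁)), Φ ∈ SK₁ →
    seesawRep₁ F E c N M₁ M₂ eW e₁ e₂ JV J₁ J₂ hcδ hδ hd hV h₁ h₂ hVd h₁d h₂d hWd hJV hJ₁ hJ₂ hs hs₁ hs₂ (1, h) Φ ∈ SK₁)
  (hρ₂ : HasThetaMajorants fun (p : adelic F E c N JV × adelic F E c M₂ J₂) (Φ : piSchwartzBruhat F (Fin N × Fin M₂)) =>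
    seesawRep₂ F E c N M₁ M₂ eW e₁ e₂ JV J₁ J₂ hcδ hδ hd hV h₁ h₂ hVd h₁d h₂d hWd hJV hJ₁ hJ₂ hs hs₁ hs₂ p Φ)
  (SK₂ : Set (piSchwartzBruhat F (Fin N × Fin M₂)))
  (hSK₂ : ∀ (h : adelic F E c M₂ J₂) (Φ : piSchwartzBruhat F (Fin N × Fin M₂)), Φ ∈ SK₂ →
    seesawRep₂ F E c N M₁ M₂ eW e₁ e₂ JV J₁ J₂ hcδ hδ hd hV h₁ h₂ hVd h₁d h₂d hWd hJV hJ₁ hJ₂ hs hs₁ hs₂ (1, h) Φ ∈ SK₂)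

omit [LocallyCompactSpace (adelic F E c M₂ J₂)] [LocallyCompactSpace (adelic F E c (M₁ + M₂) (finSum M₁ M₂ J₁ J₂))] in
/-- kernel of `seesawDatum₁` on representatives: `θ′_{Φ₁}(x, u) = Θ(ω₁′(x⁻¹, u⁻¹) Φ₁)`. [folklore] -/
theorem seesawDatum₁_thetaFun_mk (Φ₁ : piSchwartzBruhat F (Fin N × Fin M₁)) (x : adelic F E c N JV) (u : adelic F E c M₁ J₁) :
    (seesawDatum₁ F E c N M₁ M₂ eW e₁ e₂ JV J₁ J₂ hcδ hδ hd hV h₁ h₂ hVd h₁d h₂d hWd hJV hJ₁ hJ₂ hs hs₁ hs₂ hρ₁ SK₁ hSK₁).thetaFun Φ₁ (x, u) =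
      thetaDistLM F (Fin N × Fin M₁) (seesawRep₁ F E c N M₁ M₂ eW e₁ e₂ JV J₁ J₂ hcδ hδ hd hV h₁ h₂ hVd h₁d h₂d hWd hJV hJ₁ hJ₂ hs hs₁ hs₂ (x⁻¹, u⁻¹) Φ₁) :=
  rfl

omit [LocallyCompactSpace (adelic F E c M₁ J₁)] [LocallyCompactSpace (adelic F E c (M₁ + M₂) (finSum M₁ M₂ J₁ J₂))] in
/-- kernel of `seesawDatum₂` on representatives. [folklore] -/
theorem seesawDatum₂_thetaFun_mk (Φ₂ : piSchwartzBruhat F (Fin N × Fin M₂)) (x : adelic F E c N JV) (u : adelic F E c M₂ J₂) :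
    (seesawDatum₂ F E c N M₁ M₂ eW e₁ e₂ JV J₁ J₂ hcδ hδ hd hV h₁ h₂ hVd h₁d h₂d hWd hJV hJ₁ hJ₂ hs hs₁ hs₂ hρ₂ SK₂ hSK₂).thetaFun Φ₂ (x, u) =
      thetaDistLM F (Fin N × Fin M₂) (seesawRep₂ F E c N M₁ M₂ eW e₁ e₂ JV J₁ J₂ hcδ hδ hd hV h₁ h₂ hVd h₁d h₂d hWd hJV hJ₁ hJ₂ hs hs₁ hs₂ (x⁻¹, u⁻¹) Φ₂) :=
  rfl

/-! ### §2 `IsSeesawProduct` at the data of record and (eq:seesaw) -/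

omit [NumberField F] [Algebra.IsQuadraticExtension F E] [LocallyCompactSpace (adelic F E c N JV)]
  [LocallyCompactSpace (adelic F E c M₁ J₁)] [LocallyCompactSpace (adelic F E c M₂ J₂)]
  [LocallyCompactSpace (adelic F E c (M₁ + M₂) (finSum M₁ M₂ J₁ J₂))] in
/-- rational block-diagonal points are rational: `u₁ ⊕ᶠ u₂ ∈ U(J₁ ⊕ᶠ J₂)(F)` for `u_j ∈ U(J_j)(F)`. [folklore] -/
theorem blockDiag_mem_range :
    ∀ γ₁ ∈ (toAdelic F E c M₁ J₁).range, ∀ γ₂ ∈ (toAdelic F E c M₂ J₂).range,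
      adelicBlockDiag F E c M₁ M₂ J₁ J₂ (γ₁, γ₂) ∈ (toAdelic F E c (M₁ + M₂) (finSum M₁ M₂ J₁ J₂)).range := by
  rintro _ ⟨γ₁, rfl⟩ _ ⟨γ₂, rfl⟩
  exact adelicBlockDiag_toAdelic_mem_range F E c M₁ M₂ J₁ J₂ γ₁ γ₂

/-- **`IsSeesawProduct` AT THE DATA OF RECORD, `(12)` torus**: the big pair's `thetaKernelDatum` and the two renormalised
small data have product kernels along `u₁ ⊕ᶠ u₂` for the pure tensor `Φ₁ ⊗ Φ₂`. [cite: Kudla1984, §1] -/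
theorem isSeesawProduct_seesawTensor (Φ₁ : piSchwartzBruhat F (Fin N × Fin M₁)) (Φ₂ : piSchwartzBruhat F (Fin N × Fin M₂)) :
    IsSeesawProduct (thetaKernelDatum F E c N (M₁ + M₂) eW JV (finSum M₁ M₂ J₁ J₂) hcδ hδ hd hV (isSymm_finSum h₁ h₂) hVd hWd hJV
        (finSum_eq_map_finSum F E M₁ M₂ J₁ J₂ hJ₁ hJ₂) s hs hρ SK hSK) (seesawDatum₁ F E c N M₁ M₂ eW e₁ e₂ JV J₁ J₂ hcδ hδ hd hV h₁ h₂ hVd h₁d h₂d hWd hJV hJ₁ hJ₂ hs hs₁ hs₂ hρ₁ SK₁ hSK₁) (seesawDatum₂ F E c N M₁ M₂ eW e₁ e₂ JV J₁ J₂ hcδ hδ hd hV h₁ h₂ hVd h₁d h₂d hWd hJV hJ₁ hJ₂ hs hs₁ hs₂ hρ₂ SK₂ hSK₂)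
      (adelicBlockDiag F E c M₁ M₂ J₁ J₂) (seesawTensor F N M₁ M₂ eW Φ₁ Φ₂) Φ₁ Φ₂ :=
  fun x u₁ u₂ =>
    thetaKernelDatum_thetaFun_blockDiag_seesawTensor F E c N M₁ M₂ eW e₁ e₂ JV J₁ J₂ hcδ hδ hd hV h₁ h₂ hVd h₁d h₂d hWd hJV hJ₁ hJ₂ hs hs₁ hs₂ hρ SK hSK x u₁ u₂ Φ₁ Φ₂

omit [LocallyCompactSpace (adelic F E c M₁ J₁)] [LocallyCompactSpace (adelic F E c M₂ J₂)] in
/-- **`IsSeesawProduct` for the two pure tensors inside the WEDGE** and the difference law of the big kernel: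
`θ_{φ₁₁⊗φ₂₂ − φ₁₂⊗φ₂₁} = θ_{φ₁₁⊗φ₂₂} − θ_{φ₁₂⊗φ₂₁}` on representatives. [folklore] -/
theorem thetaKernelDatum_thetaFun_seesawWedge (φ₁₁ φ₁₂ : piSchwartzBruhat F (Fin N × Fin M₁))
    (φ₂₁ φ₂₂ : piSchwartzBruhat F (Fin N × Fin M₂)) (x : adelic F E c N JV)
    (y : adelic F E c (M₁ + M₂) (finSum M₁ M₂ J₁ J₂)) :
    (thetaKernelDatum F E c N (M₁ + M₂) eW JV (finSum M₁ M₂ J₁ J₂) hcδ hδ hd hV (isSymm_finSum h₁ h₂) hVd hWd hJV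
        (finSum_eq_map_finSum F E M₁ M₂ J₁ J₂ hJ₁ hJ₂) s hs hρ SK hSK).thetaFun (seesawWedge F N M₁ M₂ eW φ₁₁ φ₁₂ φ₂₁ φ₂₂) (x, y) =
      (thetaKernelDatum F E c N (M₁ + M₂) eW JV (finSum M₁ M₂ J₁ J₂) hcδ hδ hd hV (isSymm_finSum h₁ h₂) hVd hWd hJV
        (finSum_eq_map_finSum F E M₁ M₂ J₁ J₂ hJ₁ hJ₂) s hs hρ SK hSK).thetaFun (seesawTensor F N M₁ M₂ eW φ₁₁ φ₂₂) (x, y) -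
        (thetaKernelDatum F E c N (M₁ + M₂) eW JV (finSum M₁ M₂ J₁ J₂) hcδ hδ hd hV (isSymm_finSum h₁ h₂) hVd hWd hJV
        (finSum_eq_map_finSum F E M₁ M₂ J₁ J₂ hJ₁ hJ₂) s hs hρ SK hSK).thetaFun (seesawTensor F N M₁ M₂ eW φ₁₂ φ₂₁) (x, y) :=
  (congrArg (thetaDistLM F (Fin n))
      (map_sub (pairRep F E c N (M₁ + M₂) eW JV (finSum M₁ M₂ J₁ J₂) s (x, y)⁻¹)
        (seesawTensor F N M₁ M₂ eW φ₁₁ φ₂₂) (seesawTensor F N M₁ M₂ eW φ₁₂ φ₂₁))).trans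
    (map_sub (thetaDistLM F (Fin n)) _ _)

variable [CompactSpace (adelic F E c N JV ⧸ (toAdelic F E c N JV).range)]
  [CompactSpace (adelic F E c M₁ J₁ ⧸ (toAdelic F E c M₁ J₁).range)]
  [MeasurableSpace (adelic F E c M₁ J₁ ⧸ (toAdelic F E c M₁ J₁).range)]
  [BorelSpace (adelic F E c M₁ J₁ ⧸ (toAdelic F E c M₁ J₁).range)]
  (μ₁ : Measure (adelic F E c M₁ J₁ ⧸ (toAdelic F E c M₁ J₁).range)) [IsFiniteMeasure μ₁]
  [CompactSpace (adelic F E c M₂ J₂ ⧸ (toAdelic F E c M₂ J₂).range)]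
  [MeasurableSpace (adelic F E c M₂ J₂ ⧸ (toAdelic F E c M₂ J₂).range)]
  [BorelSpace (adelic F E c M₂ J₂ ⧸ (toAdelic F E c M₂ J₂).range)]
  (μ₂ : Measure (adelic F E c M₂ J₂ ⧸ (toAdelic F E c M₂ J₂).range)) [IsFiniteMeasure μ₂]

/-- **(eq:seesaw) AT THE DATA OF RECORD, `(12)` torus**: for the constructed big pair `(U(J_V), U(J₁ ⊕ᶠ J₂))` and the
renormalised small pairs, the period of the big theta kernel of `Φ₁ ⊗ Φ₂` over the see-saw torus `[U(J₁)] × [U(J₂)]`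
against `f₁ ⊠ f₂` is the product of the two small theta lifts:
`∫ θ_{Φ₁⊗Φ₂}(ξ, u₁ ⊕ᶠ u₂) f₁(u₁) f₂(u₂) d(μ₁ ⊗ μ₂) = Θ′¹_{Φ₁}(f₁)(ξ) · Θ′²_{Φ₂}(f₂)(ξ)`. [cite: Kudla1984, §1] -/
theorem seesawPeriod_eq_thetaLift_mul (Φ₁ : piSchwartzBruhat F (Fin N × Fin M₁)) (Φ₂ : piSchwartzBruhat F (Fin N × Fin M₂))
    (f₁ : C(adelic F E c M₁ J₁ ⧸ (toAdelic F E c M₁ J₁).range, ℂ))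
    (f₂ : C(adelic F E c M₂ J₂ ⧸ (toAdelic F E c M₂ J₂).range, ℂ))
    (ξ : adelic F E c N JV ⧸ (toAdelic F E c N JV).range) :
    ∫ q : (adelic F E c M₁ J₁ ⧸ (toAdelic F E c M₁ J₁).range) × (adelic F E c M₂ J₂ ⧸ (toAdelic F E c M₂ J₂).range),
        (thetaKernelDatum F E c N (M₁ + M₂) eW JV (finSum M₁ M₂ J₁ J₂) hcδ hδ hd hV (isSymm_finSum h₁ h₂) hVd hWd hJV
        (finSum_eq_map_finSum F E M₁ M₂ J₁ J₂ hJ₁ hJ₂) s hs hρ SK hSK).thetaKer (seesawTensor F N M₁ M₂ eW Φ₁ Φ₂)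
            (ξ, seesawQuot (adelicBlockDiag F E c M₁ M₂ J₁ J₂) (blockDiag_mem_range F E c M₁ M₂ J₁ J₂) q) *
          (f₁ q.1 * f₂ q.2) ∂(μ₁.prod μ₂) =
      (seesawDatum₁ F E c N M₁ M₂ eW e₁ e₂ JV J₁ J₂ hcδ hδ hd hV h₁ h₂ hVd h₁d h₂d hWd hJV hJ₁ hJ₂ hs hs₁ hs₂ hρ₁ SK₁ hSK₁).thetaLift μ₁ Φ₁ f₁ ξ * (seesawDatum₂ F E c N M₁ M₂ eW e₁ e₂ JV J₁ J₂ hcδ hδ hd hV h₁ h₂ hVd h₁d h₂d hWd hJV hJ₁ hJ₂ hs hs₁ hs₂ hρ₂ SK₂ hSK₂).thetaLift μ₂ Φ₂ f₂ ξ :=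
  seesaw_period_eq_thetaLift_mul (blockDiag_mem_range F E c M₁ M₂ J₁ J₂) μ₁ μ₂
    (isSeesawProduct_seesawTensor F E c N M₁ M₂ eW e₁ e₂ JV J₁ J₂ hcδ hδ hd hV h₁ h₂ hVd h₁d h₂d hWd hJV hJ₁ hJ₂ hs hs₁ hs₂ hρ SK hSK hρ₁ SK₁ hSK₁ hρ₂ SK₂ hSK₂ Φ₁ Φ₂) f₁ f₂ ξ

/-- **(eq:seesaw), WEDGE form at the data of record**: the period of the big theta kernel of the wedge test function
`φ₁₁ ⊗ φ₂₂ − φ₁₂ ⊗ φ₂₁` over the see-saw torus is the `2 × 2` determinant of small lifts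
`Θ′¹_{φ₁₁}(f₁) Θ′²_{φ₂₂}(f₂) − Θ′¹_{φ₁₂}(f₁) Θ′²_{φ₂₁}(f₂)` at `ξ` — the global wedge-function of two vector-valued theta
forms IS one torus period. [cite: Kudla1984, §1] -/
theorem seesawPeriod_wedge_eq_det (φ₁₁ φ₁₂ : piSchwartzBruhat F (Fin N × Fin M₁))
    (φ₂₁ φ₂₂ : piSchwartzBruhat F (Fin N × Fin M₂))
    (f₁ : C(adelic F E c M₁ J₁ ⧸ (toAdelic F E c M₁ J₁).range, ℂ))
    (f₂ : C(adelic F E c M₂ J₂ ⧸ (toAdelic F E c M₂ J₂).range, ℂ))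
    (ξ : adelic F E c N JV ⧸ (toAdelic F E c N JV).range) :
    ∫ q : (adelic F E c M₁ J₁ ⧸ (toAdelic F E c M₁ J₁).range) × (adelic F E c M₂ J₂ ⧸ (toAdelic F E c M₂ J₂).range),
        (thetaKernelDatum F E c N (M₁ + M₂) eW JV (finSum M₁ M₂ J₁ J₂) hcδ hδ hd hV (isSymm_finSum h₁ h₂) hVd hWd hJV
        (finSum_eq_map_finSum F E M₁ M₂ J₁ J₂ hJ₁ hJ₂) s hs hρ SK hSK).thetaKer (seesawWedge F N M₁ M₂ eW φ₁₁ φ₁₂ φ₂₁ φ₂₂)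
            (ξ, seesawQuot (adelicBlockDiag F E c M₁ M₂ J₁ J₂) (blockDiag_mem_range F E c M₁ M₂ J₁ J₂) q) *
          (f₁ q.1 * f₂ q.2) ∂(μ₁.prod μ₂) =
      (seesawDatum₁ F E c N M₁ M₂ eW e₁ e₂ JV J₁ J₂ hcδ hδ hd hV h₁ h₂ hVd h₁d h₂d hWd hJV hJ₁ hJ₂ hs hs₁ hs₂ hρ₁ SK₁ hSK₁).thetaLift μ₁ φ₁₁ f₁ ξ * (seesawDatum₂ F E c N M₁ M₂ eW e₁ e₂ JV J₁ J₂ hcδ hδ hd hV h₁ h₂ hVd h₁d h₂d hWd hJV hJ₁ hJ₂ hs hs₁ hs₂ hρ₂ SK₂ hSK₂).thetaLift μ₂ φ₂₂ f₂ ξ -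
        (seesawDatum₁ F E c N M₁ M₂ eW e₁ e₂ JV J₁ J₂ hcδ hδ hd hV h₁ h₂ hVd h₁d h₂d hWd hJV hJ₁ hJ₂ hs hs₁ hs₂ hρ₁ SK₁ hSK₁).thetaLift μ₁ φ₁₂ f₁ ξ *
          (seesawDatum₂ F E c N M₁ M₂ eW e₁ e₂ JV J₁ J₂ hcδ hδ hd hV h₁ h₂ hVd h₁d h₂d hWd hJV hJ₁ hJ₂ hs hs₁ hs₂ hρ₂ SK₂ hSK₂).thetaLift μ₂ φ₂₁ f₂ ξ :=
  seesaw_period_wedge_eq_det (blockDiag_mem_range F E c M₁ M₂ J₁ J₂) μ₁ μ₂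
    (thetaKernelDatum_thetaFun_seesawWedge F E c N M₁ M₂ eW JV J₁ J₂ hcδ hδ hd hV h₁ h₂ hVd hWd hJV hJ₁ hJ₂ hs hρ SK hSK φ₁₁ φ₁₂ φ₂₁ φ₂₂)
    (isSeesawProduct_seesawTensor F E c N M₁ M₂ eW e₁ e₂ JV J₁ J₂ hcδ hδ hd hV h₁ h₂ hVd h₁d h₂d hWd hJV hJ₁ hJ₂ hs hs₁ hs₂ hρ SK hSK hρ₁ SK₁ hSK₁ hρ₂ SK₂ hSK₂ φ₁₁ φ₂₂)
    (isSeesawProduct_seesawTensor F E c N M₁ M₂ eW e₁ e₂ JV J₁ J₂ hcδ hδ hd hV h₁ h₂ hVd h₁d h₂d hWd hJV hJ₁ hJ₂ hs hs₁ hs₂ hρ SK hSK hρ₁ SK₁ hSK₁ hρ₂ SK₂ hSK₂ φ₁₂ φ₂₁) f₁ f₂ ξ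

end Twelve

/-! ## §3 The conjugated `(34)` torus -/

section ThirtyFour

variable (F E : Type) [Field F] [NumberField F] [Field E] [NumberField E] [Algebra F E]
variable (c : E ≃ₐ[F] E) (N M₁ M₂ : ℕ) {n n₁ n₂ : ℕ} (eW : Fin N × Fin (M₁ + M₂) ≃ Fin n)
  (e₁ : Fin N × Fin M₁ ≃ Fin n₁) (e₂ : Fin N × Fin M₂ ≃ Fin n₂)
variable (JV : Matrix (Fin N) (Fin N) E) (JW : Matrix (Fin (M₁ + M₂)) (Fin (M₁ + M₂)) E)
  (J₁ : Matrix (Fin M₁) (Fin M₁) E) (J₂ : Matrix (Fin M₂) (Fin M₂) E)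
variable {TV : Matrix (Fin N) (Fin N) F} {TW : Matrix (Fin (M₁ + M₂)) (Fin (M₁ + M₂)) F}
  {T₁ : Matrix (Fin M₁) (Fin M₁) F} {T₂ : Matrix (Fin M₂) (Fin M₂) F}
variable [Algebra.IsQuadraticExtension F E] {δ : E} (hcδ : c δ = -δ) (hδ : δ ≠ 0) {d : F}
  (hd : δ * δ = algebraMap F E d) (hV : TV.IsSymm) (hW : TW.IsSymm) (h₁ : T₁.IsSymm) (h₂ : T₂.IsSymm)
  (hVd : IsUnit TV.det) (hTWd : IsUnit TW.det) (h₁d : IsUnit T₁.det) (h₂d : IsUnit T₂.det)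
  (hT : IsUnit (TV.map (algebraMap F (AdeleRing (𝓞 F) F)) ⊗ₖ TW.map (algebraMap F (AdeleRing (𝓞 F) F))).det)
  (hJV : JV = TV.map (algebraMap F E)) (hJW : JW = TW.map (algebraMap F E))
  (hJ₁ : J₁ = T₁.map (algebraMap F E)) (hJ₂ : J₂ = T₂.map (algebraMap F E))
  {s : adelicPair F E c N (M₁ + M₂) JV JW →* adelicMpCont F (Fin n) (adelicGram F eW TV TW)}
  {s₁ : adelicPair F E c N M₁ JV J₁ →* adelicMpCont F (Fin n₁) (adelicGram F e₁ TV T₁)}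
  {s₂ : adelicPair F E c N M₂ JV J₂ →* adelicMpCont F (Fin n₂) (adelicGram F e₂ TV T₂)}
  {g : GL (Fin (M₁ + M₂)) (AdeleRing (𝓞 E) E)} {g₀ : GL (Fin (M₁ + M₂)) E}
  (hgg₀ : (g : Matrix (Fin (M₁ + M₂)) (Fin (M₁ + M₂)) (AdeleRing (𝓞 E) E)) =
    ((g₀ : GL (Fin (M₁ + M₂)) E) : Matrix (Fin (M₁ + M₂)) (Fin (M₁ + M₂)) E).map (algebraMap E (AdeleRing (𝓞 E) E)))
  (hg : ((g : Matrix (Fin (M₁ + M₂)) (Fin (M₁ + M₂)) (AdeleRing (𝓞 E) E)).map (conjAdele F E c))ᵀ *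
      adelicForm E (M₁ + M₂) JW * g = adelicForm E (M₁ + M₂) (finSum M₁ M₂ J₁ J₂))
  {C : GL (Fin N × Fin (M₁ + M₂)) (AdeleRing (𝓞 F) F)} {C₀ : GL (Fin N × Fin (M₁ + M₂)) F}
  (hCC₀ : (C : Matrix (Fin N × Fin (M₁ + M₂)) (Fin N × Fin (M₁ + M₂)) (AdeleRing (𝓞 F) F)) =
    ((C₀ : GL (Fin N × Fin (M₁ + M₂)) F) : Matrix (Fin N × Fin (M₁ + M₂)) (Fin N × Fin (M₁ + M₂)) F).map
      (algebraMap F (AdeleRing (𝓞 F) F)))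
  (hC : TV.map (algebraMap F (AdeleRing (𝓞 F) F)) ⊗ₖ TW.map (algebraMap F (AdeleRing (𝓞 F) F)) *
      (C : Matrix (Fin N × Fin (M₁ + M₂)) (Fin N × Fin (M₁ + M₂)) (AdeleRing (𝓞 F) F)) =
    TV.map (algebraMap F (AdeleRing (𝓞 F) F)) ⊗ₖ (finSum M₁ M₂ T₁ T₂).map (algebraMap F (AdeleRing (𝓞 F) F)))
  (hs : (splittingDatum F E c N (M₁ + M₂) eW JV JW hcδ hδ hd hV hW hVd hTWd hJV hJW).IsCompatible s)
  (hs₁ : (splittingDatum F E c N M₁ e₁ JV J₁ hcδ hδ hd hV h₁ hVd h₁d hJV hJ₁).IsCompatible s₁)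
  (hs₂ : (splittingDatum F E c N M₂ e₂ JV J₂ hcδ hδ hd hV h₂ hVd h₂d hJV hJ₂).IsCompatible s₂)
  (hg₀ : (((g₀ : GL (Fin (M₁ + M₂)) E) : Matrix (Fin (M₁ + M₂)) (Fin (M₁ + M₂)) E).map (c : E →+* E))ᵀ * JW * g₀ =
    finSum M₁ M₂ J₁ J₂)

include hg₀ in
/-- the conjugated see-saw character of the first small pair is `1` at rational points: `λ_V′ γ_U · λ₃ γ = 1`.
[cite: Weil1964, Chap. III n° 41 Thm 6 p. 193] -/
theorem seesawConjChar₁_eq_one_of_rational {γU : adelic F E c N JV} (hγU : γU ∈ (toAdelic F E c N JV).range)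
    {γ : adelic F E c M₁ J₁} (hγ : γ ∈ (toAdelic F E c M₁ J₁).range) :
    mpCharSmall₁ (seesawConjSum F E c N M₁ M₂ eW JV JW J₁ J₂ hcδ hδ hd hV hW h₁ h₂ hVd hTWd hT hJV hJW hJ₁ hJ₂ hgg₀ hg hCC₀ hC (s := s)) (pairSmall₁ F E c N M₁ e₁ JV J₁ s₁) (pairSmall₂ F E c N M₂ e₂ JV J₂ s₂)
        (hs₃_seesawConj F E c N M₁ M₂ eW e₁ e₂ JV JW J₁ J₂ hcδ hδ hd hV hW h₁ h₂ hVd hTWd h₁d h₂d hT hJV hJW hJ₁ hJ₂ hgg₀ hg hCC₀ hC hs hs₁ hs₂) (isUnit_kronecker_map F N hVd h₁d) (isUnit_kronecker_map F N hVd h₂d) (γU, γ) = 1 := by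
  have hcV : charV₃₄ F E c N M₁ M₂ eW e₁ e₂ JV JW J₁ J₂ hcδ hδ hd hV hW h₁ h₂ hVd hTWd h₁d h₂d hT hJV hJW hJ₁ hJ₂ hgg₀ hg hCC₀ hC hs hs₁ hs₂ γU = 1 := charV₃₄_eq_one_of_rational F E c N M₁ M₂ eW e₁ e₂ JV JW J₁ J₂ hcδ hδ hd hV hW h₁ h₂ hVd hTWd h₁d h₂d hT hJV hJW hJ₁ hJ₂ hgg₀ hg hCC₀ hC hs hs₁ hs₂ hg₀ hγU
  have hc3 : char₃ F E c N M₁ M₂ eW e₁ e₂ JV JW J₁ J₂ hcδ hδ hd hV hW h₁ h₂ hVd hTWd h₁d h₂d hT hJV hJW hJ₁ hJ₂ hgg₀ hg hCC₀ hC hs hs₁ hs₂ γ = 1 := char₃_eq_one_of_rational F E c N M₁ M₂ eW e₁ e₂ JV JW J₁ J₂ hcδ hδ hd hV hW h₁ h₂ hVd hTWd h₁d h₂d hT hJV hJW hJ₁ hJ₂ hgg₀ hg hCC₀ hC hs hs₁ hs₂ hg₀ hγ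
  refine (mpCharSmall₁_apply_eq_mul _ _ _ _ _ _ γU γ).trans ?_
  exact (congrArg₂ (· * ·) hcV hc3).trans (mul_one 1)

include hg₀ in
/-- the conjugated see-saw character of the second small pair is `1` at rational points: `λ₄ γ = 1`.
[cite: Weil1964, Chap. III n° 41 Thm 6 p. 193] -/
theorem seesawConjChar₂_eq_one_of_rational (γU : adelic F E c N JV)
    {γ : adelic F E c M₂ J₂} (hγ : γ ∈ (toAdelic F E c M₂ J₂).range) :
    mpCharSmall₂ (seesawConjSum F E c N M₁ M₂ eW JV JW J₁ J₂ hcδ hδ hd hV hW h₁ h₂ hVd hTWd hT hJV hJW hJ₁ hJ₂ hgg₀ hg hCC₀ hC (s := s)) (pairSmall₁ F E c N M₁ e₁ JV J₁ s₁) (pairSmall₂ F E c N M₂ e₂ JV J₂ s₂)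
        (hs₃_seesawConj F E c N M₁ M₂ eW e₁ e₂ JV JW J₁ J₂ hcδ hδ hd hV hW h₁ h₂ hVd hTWd h₁d h₂d hT hJV hJW hJ₁ hJ₂ hgg₀ hg hCC₀ hC hs hs₁ hs₂) (isUnit_kronecker_map F N hVd h₁d) (isUnit_kronecker_map F N hVd h₂d) (γU, γ) = 1 :=
  (mpCharSmall₂_apply _ _ _ _ _ _ γU γ).trans (char₄_eq_one_of_rational F E c N M₁ M₂ eW e₁ e₂ JV JW J₁ J₂ hcδ hδ hd hV hW h₁ h₂ hVd hTWd h₁d h₂d hT hJV hJW hJ₁ hJ₂ hgg₀ hg hCC₀ hC hs hs₁ hs₂ hg₀ hγ)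

include hg₀ in
/-- **`ω₁″(γ_U, γ)` fixes `Θ`** for `γ_U ∈ U(J_V)(F)`, `γ ∈ U(J₁)(F)`. [cite: Weil1964, Chap. III n° 41 Thm 6 p. 193] -/
theorem seesawConjRep₁_toHomUnits_mem_thetaStabilizer {γU : adelic F E c N JV}
    (hγU : γU ∈ (toAdelic F E c N JV).range) {γ : adelic F E c M₁ J₁} (hγ : γ ∈ (toAdelic F E c M₁ J₁).range) :
    (seesawConjRep₁ F E c N M₁ M₂ eW e₁ e₂ JV JW J₁ J₂ hcδ hδ hd hV hW h₁ h₂ hVd hTWd h₁d h₂d hT hJV hJW hJ₁ hJ₂ hgg₀ hg hCC₀ hC hs hs₁ hs₂).toHomUnits (γU, γ) ∈ thetaStabilizer F (Fin N × Fin M₁) :=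
  (toHomUnits_mem_thetaStabilizer_iff _ _).2 fun Φ =>
    (congrArg (thetaDistLM F (Fin N × Fin M₁))
        (LinearMap.congr_fun (SeesawScalar.twist_apply_of_eq_one _
          (seesawConjChar₁_eq_one_of_rational F E c N M₁ M₂ eW e₁ e₂ JV JW J₁ J₂ hcδ hδ hd hV hW h₁ h₂ hVd hTWd h₁d h₂d hT hJV hJW hJ₁ hJ₂ hgg₀ hg hCC₀ hC hs hs₁ hs₂ hg₀ hγU hγ)) Φ)).trans
      (thetaDistLM_omega_of_mem_adelicMpTheta
        (coe_pairSmall₁_mem_adelicMpTheta F E c N M₁ e₁ JV J₁ hcδ hδ hd hV h₁ hVd h₁d hJV hJ₁ hs₁ hγU hγ) Φ)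

include hg₀ in
/-- **`ω₂″(γ_U, γ)` fixes `Θ`** for `γ_U ∈ U(J_V)(F)`, `γ ∈ U(J₂)(F)`. [cite: Weil1964, Chap. III n° 41 Thm 6 p. 193] -/
theorem seesawConjRep₂_toHomUnits_mem_thetaStabilizer {γU : adelic F E c N JV}
    (hγU : γU ∈ (toAdelic F E c N JV).range) {γ : adelic F E c M₂ J₂} (hγ : γ ∈ (toAdelic F E c M₂ J₂).range) :
    (seesawConjRep₂ F E c N M₁ M₂ eW e₁ e₂ JV JW J₁ J₂ hcδ hδ hd hV hW h₁ h₂ hVd hTWd h₁d h₂d hT hJV hJW hJ₁ hJ₂ hgg₀ hg hCC₀ hC hs hs₁ hs₂).toHomUnits (γU, γ) ∈ thetaStabilizer F (Fin N × Fin M₂) :=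
  (toHomUnits_mem_thetaStabilizer_iff _ _).2 fun Φ =>
    (congrArg (thetaDistLM F (Fin N × Fin M₂))
        (LinearMap.congr_fun (SeesawScalar.twist_apply_of_eq_one _
          (seesawConjChar₂_eq_one_of_rational F E c N M₁ M₂ eW e₁ e₂ JV JW J₁ J₂ hcδ hδ hd hV hW h₁ h₂ hVd hTWd h₁d h₂d hT hJV hJW hJ₁ hJ₂ hgg₀ hg hCC₀ hC hs hs₁ hs₂ hg₀ γU hγ)) Φ)).trans
      (thetaDistLM_omega_of_mem_adelicMpTheta
        (coe_pairSmall₂_mem_adelicMpTheta F E c N M₂ e₂ JV J₂ hcδ hδ hd hV h₂ hVd h₂d hJV hJ₂ hs₂ hγU hγ) Φ)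

variable [LocallyCompactSpace (adelic F E c N JV)] [LocallyCompactSpace (adelic F E c M₁ J₁)]
  [LocallyCompactSpace (adelic F E c M₂ J₂)] [LocallyCompactSpace (adelic F E c (M₁ + M₂) JW)]

include hg₀ in
/-- **THE THETA-KERNEL DATUM OF THE FIRST RENORMALISED SMALL PAIR, conjugated torus** (`adelicOfDualPairRep` at `ω₁″`).
HYPOTHESIS **`hM₃`** = Weil's majorants for `ω₁″ = seesawConjRep₁` (NOT derived here: no continuity of `λ_V′` is claimed for a
general conjugator `g`; discharged where `g` is pinned), `SK₁`/`hSK₁` = an `U(J₁)(𝔸)`-stable index set.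
[cite: Weil1964, Chap. III n° 41 Thm 6 p. 193] -/
def seesawConjDatum₁
    (hM₃ : HasThetaMajorants fun (p : adelic F E c N JV × adelic F E c M₁ J₁) (Φ : piSchwartzBruhat F (Fin N × Fin M₁)) =>
      seesawConjRep₁ F E c N M₁ M₂ eW e₁ e₂ JV JW J₁ J₂ hcδ hδ hd hV hW h₁ h₂ hVd hTWd h₁d h₂d hT hJV hJW hJ₁ hJ₂ hgg₀ hg hCC₀ hC hs hs₁ hs₂ p Φ)
    (SK₁ : Set (piSchwartzBruhat F (Fin N × Fin M₁)))
    (hSK₁ : ∀ (h : adelic F E c M₁ J₁) (Φ : piSchwartzBruhat F (Fin N × Fin M₁)), Φ ∈ SK₁ →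
      seesawConjRep₁ F E c N M₁ M₂ eW e₁ e₂ JV JW J₁ J₂ hcδ hδ hd hV hW h₁ h₂ hVd hTWd h₁d h₂d hT hJV hJW hJ₁ hJ₂ hgg₀ hg hCC₀ hC hs hs₁ hs₂ (1, h) Φ ∈ SK₁) :
    ThetaKernelDatum (adelic F E c N JV × adelic F E c M₁ J₁)
      (repWeilThetaDatum F (Fin N × Fin M₁) (seesawConjRep₁ F E c N M₁ M₂ eW e₁ e₂ JV JW J₁ J₂ hcδ hδ hd hV hW h₁ h₂ hVd hTWd h₁d h₂d hT hJV hJW hJ₁ hJ₂ hgg₀ hg hCC₀ hC hs hs₁ hs₂).toHomUnits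
        ((((toAdelic F E c N JV).range).prod (toAdelic F E c M₁ J₁).range :
            Subgroup (adelic F E c N JV × adelic F E c M₁ J₁)) :
          Set (adelic F E c N JV × adelic F E c M₁ J₁))).ThetaTop
      (adelic F E c N JV) (toAdelic F E c N JV).range (adelic F E c M₁ J₁) (toAdelic F E c M₁ J₁).range :=
  ThetaKernelDatum.adelicOfDualPairRep (ΓU := (toAdelic F E c N JV).range) (Γ := (toAdelic F E c M₁ J₁).range)
    (seesawConjRep₁ F E c N M₁ M₂ eW e₁ e₂ JV JW J₁ J₂ hcδ hδ hd hV hW h₁ h₂ hVd hTWd h₁d h₂d hT hJV hJW hJ₁ hJ₂ hgg₀ hg hCC₀ hC hs hs₁ hs₂) hM₃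
    (fun _ hγU _ hγ => seesawConjRep₁_toHomUnits_mem_thetaStabilizer F E c N M₁ M₂ eW e₁ e₂ JV JW J₁ J₂ hcδ hδ hd hV hW h₁ h₂ hVd hTWd h₁d h₂d hT hJV hJW hJ₁ hJ₂ hgg₀ hg hCC₀ hC hs hs₁ hs₂ hg₀ hγU hγ) SK₁ hSK₁

include hg₀ in
/-- **THE THETA-KERNEL DATUM OF THE SECOND RENORMALISED SMALL PAIR, conjugated torus** (`adelicOfDualPairRep` at `ω₂″`).
HYPOTHESIS **`hM₄`** = Weil's majorants for `ω₂″ = seesawConjRep₂` (not derived here), `SK₂`/`hSK₂` = an `U(J₂)(𝔸)`-stable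
index set. [cite: Weil1964, Chap. III n° 41 Thm 6 p. 193] -/
def seesawConjDatum₂
    (hM₄ : HasThetaMajorants fun (p : adelic F E c N JV × adelic F E c M₂ J₂) (Φ : piSchwartzBruhat F (Fin N × Fin M₂)) =>
      seesawConjRep₂ F E c N M₁ M₂ eW e₁ e₂ JV JW J₁ J₂ hcδ hδ hd hV hW h₁ h₂ hVd hTWd h₁d h₂d hT hJV hJW hJ₁ hJ₂ hgg₀ hg hCC₀ hC hs hs₁ hs₂ p Φ)
    (SK₂ : Set (piSchwartzBruhat F (Fin N × Fin M₂)))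
    (hSK₂ : ∀ (h : adelic F E c M₂ J₂) (Φ : piSchwartzBruhat F (Fin N × Fin M₂)), Φ ∈ SK₂ →
      seesawConjRep₂ F E c N M₁ M₂ eW e₁ e₂ JV JW J₁ J₂ hcδ hδ hd hV hW h₁ h₂ hVd hTWd h₁d h₂d hT hJV hJW hJ₁ hJ₂ hgg₀ hg hCC₀ hC hs hs₁ hs₂ (1, h) Φ ∈ SK₂) :
    ThetaKernelDatum (adelic F E c N JV × adelic F E c M₂ J₂)
      (repWeilThetaDatum F (Fin N × Fin M₂) (seesawConjRep₂ F E c N M₁ M₂ eW e₁ e₂ JV JW J₁ J₂ hcδ hδ hd hV hW h₁ h₂ hVd hTWd h₁d h₂d hT hJV hJW hJ₁ hJ₂ hgg₀ hg hCC₀ hC hs hs₁ hs₂).toHomUnits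
        ((((toAdelic F E c N JV).range).prod (toAdelic F E c M₂ J₂).range :
            Subgroup (adelic F E c N JV × adelic F E c M₂ J₂)) :
          Set (adelic F E c N JV × adelic F E c M₂ J₂))).ThetaTop
      (adelic F E c N JV) (toAdelic F E c N JV).range (adelic F E c M₂ J₂) (toAdelic F E c M₂ J₂).range :=
  ThetaKernelDatum.adelicOfDualPairRep (ΓU := (toAdelic F E c N JV).range) (Γ := (toAdelic F E c M₂ J₂).range)
    (seesawConjRep₂ F E c N M₁ M₂ eW e₁ e₂ JV JW J₁ J₂ hcδ hδ hd hV hW h₁ h₂ hVd hTWd h₁d h₂d hT hJV hJW hJ₁ hJ₂ hgg₀ hg hCC₀ hC hs hs₁ hs₂) hM₄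
    (fun _ hγU _ hγ => seesawConjRep₂_toHomUnits_mem_thetaStabilizer F E c N M₁ M₂ eW e₁ e₂ JV JW J₁ J₂ hcδ hδ hd hV hW h₁ h₂ hVd hTWd h₁d h₂d hT hJV hJW hJ₁ hJ₂ hgg₀ hg hCC₀ hC hs hs₁ hs₂ hg₀ hγU hγ) SK₂ hSK₂

variable
  (hρ : HasThetaMajorants fun (p : adelic F E c N JV × adelic F E c (M₁ + M₂) JW)
    (Φ : piSchwartzBruhat F (Fin n)) => pairRep F E c N (M₁ + M₂) eW JV JW s p Φ)
  (SK : Set (piSchwartzBruhat F (Fin n)))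
  (hSK : ∀ (h : adelic F E c (M₁ + M₂) JW) (Φ : piSchwartzBruhat F (Fin n)), Φ ∈ SK →
    pairRep F E c N (M₁ + M₂) eW JV JW s (1, h) Φ ∈ SK)
  (hM₃ : HasThetaMajorants fun (p : adelic F E c N JV × adelic F E c M₁ J₁) (Φ : piSchwartzBruhat F (Fin N × Fin M₁)) =>
    seesawConjRep₁ F E c N M₁ M₂ eW e₁ e₂ JV JW J₁ J₂ hcδ hδ hd hV hW h₁ h₂ hVd hTWd h₁d h₂d hT hJV hJW hJ₁ hJ₂ hgg₀ hg hCC₀ hC hs hs₁ hs₂ p Φ)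
  (SK₁ : Set (piSchwartzBruhat F (Fin N × Fin M₁)))
  (hSK₁ : ∀ (h : adelic F E c M₁ J₁) (Φ : piSchwartzBruhat F (Fin N × Fin M₁)), Φ ∈ SK₁ →
    seesawConjRep₁ F E c N M₁ M₂ eW e₁ e₂ JV JW J₁ J₂ hcδ hδ hd hV hW h₁ h₂ hVd hTWd h₁d h₂d hT hJV hJW hJ₁ hJ₂ hgg₀ hg hCC₀ hC hs hs₁ hs₂ (1, h) Φ ∈ SK₁)
  (hM₄ : HasThetaMajorants fun (p : adelic F E c N JV × adelic F E c M₂ J₂) (Φ : piSchwartzBruhat F (Fin N × Fin M₂)) =>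
    seesawConjRep₂ F E c N M₁ M₂ eW e₁ e₂ JV JW J₁ J₂ hcδ hδ hd hV hW h₁ h₂ hVd hTWd h₁d h₂d hT hJV hJW hJ₁ hJ₂ hgg₀ hg hCC₀ hC hs hs₁ hs₂ p Φ)
  (SK₂ : Set (piSchwartzBruhat F (Fin N × Fin M₂)))
  (hSK₂ : ∀ (h : adelic F E c M₂ J₂) (Φ : piSchwartzBruhat F (Fin N × Fin M₂)), Φ ∈ SK₂ →
    seesawConjRep₂ F E c N M₁ M₂ eW e₁ e₂ JV JW J₁ J₂ hcδ hδ hd hV hW h₁ h₂ hVd hTWd h₁d h₂d hT hJV hJW hJ₁ hJ₂ hgg₀ hg hCC₀ hC hs hs₁ hs₂ (1, h) Φ ∈ SK₂)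

omit [NumberField F] [Algebra.IsQuadraticExtension F E] [LocallyCompactSpace (adelic F E c N JV)]
  [LocallyCompactSpace (adelic F E c M₁ J₁)] [LocallyCompactSpace (adelic F E c M₂ J₂)]
  [LocallyCompactSpace (adelic F E c (M₁ + M₂) JW)] in
include hgg₀ hg₀ in
/-- rational points of the conjugated torus are rational: `g (γ₁ ⊕ᶠ γ₂) g⁻¹ ∈ U(J_W)(F)` for `γ_j ∈ U(J_j)(F)` (`g`
rational). [folklore] -/
theorem isometryConj_blockDiag_mem_range :
    ∀ γ₁ ∈ (toAdelic F E c M₁ J₁).range, ∀ γ₂ ∈ (toAdelic F E c M₂ J₂).range,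
      ((adelicIsometryConj F E c (M₁ + M₂) g hg).comp (adelicBlockDiag F E c M₁ M₂ J₁ J₂)) (γ₁, γ₂) ∈
        (toAdelic F E c (M₁ + M₂) JW).range :=
  fun γ₁ hγ₁ γ₂ hγ₂ =>
    adelicIsometryConj_toAdelic_mem_range F E c g hg g₀ hg₀ hgg₀ (blockDiag_mem_range F E c M₁ M₂ J₁ J₂ γ₁ hγ₁ γ₂ hγ₂)

/-- **`IsSeesawProduct` AT THE DATA OF RECORD, conjugated `(34)` torus**: product kernels along
`(u₁, u₂) ↦ g (u₁ ⊕ᶠ u₂) g⁻¹` for the conjugated pure tensor `seesawConjTensor Φ₁ Φ₂`. [cite: Kudla1984, §1] -/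
theorem isSeesawProduct_seesawConjTensor (Φ₁ : piSchwartzBruhat F (Fin N × Fin M₁))
    (Φ₂ : piSchwartzBruhat F (Fin N × Fin M₂)) :
    IsSeesawProduct (thetaKernelDatum F E c N (M₁ + M₂) eW JV JW hcδ hδ hd hV hW hVd hTWd hJV hJW s hs hρ SK hSK) (seesawConjDatum₁ F E c N M₁ M₂ eW e₁ e₂ JV JW J₁ J₂ hcδ hδ hd hV hW h₁ h₂ hVd hTWd h₁d h₂d hT hJV hJW hJ₁ hJ₂ hgg₀ hg hCC₀ hC hs hs₁ hs₂ hg₀ hM₃ SK₁ hSK₁)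
      (seesawConjDatum₂ F E c N M₁ M₂ eW e₁ e₂ JV JW J₁ J₂ hcδ hδ hd hV hW h₁ h₂ hVd hTWd h₁d h₂d hT hJV hJW hJ₁ hJ₂ hgg₀ hg hCC₀ hC hs hs₁ hs₂ hg₀ hM₄ SK₂ hSK₂)
      ((adelicIsometryConj F E c (M₁ + M₂) g hg).comp (adelicBlockDiag F E c M₁ M₂ J₁ J₂))
      (seesawConjTensor F E c N M₁ M₂ eW JV JW J₁ J₂ hcδ hδ hd hV hW h₁ h₂ hVd hTWd hT hJV hJW hJ₁ hJ₂ hgg₀ hg hCC₀ hC Φ₁ Φ₂) Φ₁ Φ₂ :=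
  fun x u₁ u₂ =>
    thetaKernelDatum_thetaFun_isometryConj_seesawConjTensor F E c N M₁ M₂ eW e₁ e₂ JV JW J₁ J₂ hcδ hδ hd hV hW h₁ h₂ hVd hTWd h₁d h₂d hT hJV hJW hJ₁ hJ₂ hgg₀ hg hCC₀ hC hs hs₁ hs₂ hρ SK hSK x u₁ u₂ Φ₁ Φ₂

variable [CompactSpace (adelic F E c N JV ⧸ (toAdelic F E c N JV).range)]
  [CompactSpace (adelic F E c M₁ J₁ ⧸ (toAdelic F E c M₁ J₁).range)]
  [MeasurableSpace (adelic F E c M₁ J₁ ⧸ (toAdelic F E c M₁ J₁).range)]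
  [BorelSpace (adelic F E c M₁ J₁ ⧸ (toAdelic F E c M₁ J₁).range)]
  (μ₁ : Measure (adelic F E c M₁ J₁ ⧸ (toAdelic F E c M₁ J₁).range)) [IsFiniteMeasure μ₁]
  [CompactSpace (adelic F E c M₂ J₂ ⧸ (toAdelic F E c M₂ J₂).range)]
  [MeasurableSpace (adelic F E c M₂ J₂ ⧸ (toAdelic F E c M₂ J₂).range)]
  [BorelSpace (adelic F E c M₂ J₂ ⧸ (toAdelic F E c M₂ J₂).range)]
  (μ₂ : Measure (adelic F E c M₂ J₂ ⧸ (toAdelic F E c M₂ J₂).range)) [IsFiniteMeasure μ₂]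

/-- **(eq:seesaw) AT THE DATA OF RECORD, conjugated `(34)` torus** («the same holds for type (34) with T′»): the
period of the big theta kernel of the conjugated pure tensor over the conjugated torus `[U(J₁)] × [U(J₂)] → [U(J_W)]`,
`(u₁,u₂) ↦ g (u₁ ⊕ᶠ u₂) g⁻¹`, against `f₁ ⊠ f₂` is the product of the two renormalised small theta lifts.
[cite: Kudla1984, §1] -/
theorem seesawConjPeriod_eq_thetaLift_mul (Φ₁ : piSchwartzBruhat F (Fin N × Fin M₁))
    (Φ₂ : piSchwartzBruhat F (Fin N × Fin M₂))
    (f₁ : C(adelic F E c M₁ J₁ ⧸ (toAdelic F E c M₁ J₁).range, ℂ))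
    (f₂ : C(adelic F E c M₂ J₂ ⧸ (toAdelic F E c M₂ J₂).range, ℂ))
    (ξ : adelic F E c N JV ⧸ (toAdelic F E c N JV).range) :
    ∫ q : (adelic F E c M₁ J₁ ⧸ (toAdelic F E c M₁ J₁).range) × (adelic F E c M₂ J₂ ⧸ (toAdelic F E c M₂ J₂).range),
        (thetaKernelDatum F E c N (M₁ + M₂) eW JV JW hcδ hδ hd hV hW hVd hTWd hJV hJW s hs hρ SK hSK).thetaKer (seesawConjTensor F E c N M₁ M₂ eW JV JW J₁ J₂ hcδ hδ hd hV hW h₁ h₂ hVd hTWd hT hJV hJW hJ₁ hJ₂ hgg₀ hg hCC₀ hC Φ₁ Φ₂)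
            (ξ, seesawQuot ((adelicIsometryConj F E c (M₁ + M₂) g hg).comp (adelicBlockDiag F E c M₁ M₂ J₁ J₂))
              (isometryConj_blockDiag_mem_range F E c M₁ M₂ JW J₁ J₂ hgg₀ hg hg₀) q) *
          (f₁ q.1 * f₂ q.2) ∂(μ₁.prod μ₂) =
      (seesawConjDatum₁ F E c N M₁ M₂ eW e₁ e₂ JV JW J₁ J₂ hcδ hδ hd hV hW h₁ h₂ hVd hTWd h₁d h₂d hT hJV hJW hJ₁ hJ₂ hgg₀ hg hCC₀ hC hs hs₁ hs₂ hg₀ hM₃ SK₁ hSK₁).thetaLift μ₁ Φ₁ f₁ ξ *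
        (seesawConjDatum₂ F E c N M₁ M₂ eW e₁ e₂ JV JW J₁ J₂ hcδ hδ hd hV hW h₁ h₂ hVd hTWd h₁d h₂d hT hJV hJW hJ₁ hJ₂ hgg₀ hg hCC₀ hC hs hs₁ hs₂ hg₀ hM₄ SK₂ hSK₂).thetaLift μ₂ Φ₂ f₂ ξ :=
  seesaw_period_eq_thetaLift_mul (isometryConj_blockDiag_mem_range F E c M₁ M₂ JW J₁ J₂ hgg₀ hg hg₀) μ₁ μ₂
    (isSeesawProduct_seesawConjTensor F E c N M₁ M₂ eW e₁ e₂ JV JW J₁ J₂ hcδ hδ hd hV hW h₁ h₂ hVd hTWd h₁d h₂d hT hJV hJW hJ₁ hJ₂ hgg₀ hg hCC₀ hC hs hs₁ hs₂ hg₀ hρ SK hSK hM₃ SK₁ hSK₁ hM₄ SK₂ hSK₂ Φ₁ Φ₂) f₁ f₂ ξ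

end ThirtyFour

end UnitaryDualPair

end Literature.NumberTheory.GelbartRogawski1991

end

/-! ### Build-lane note (ops-buildfix G11b-3 recipe v2, LEDGER B13-1/B14-5/B14-7, 2026-08-22)
`lean -o` (the hub build lane, never `lean`/the gate check) runs Lean 4.32's library-suggestion indexers
(`Lean.LibrarySuggestions.SymbolFrequency` / `SineQuaNon`, from their `exportEntriesFn`) over the statement of every local
theorem constant that is not a denied premise; on this family's statements (very large dependent binder telescopes) that fold
runs for tens of minutes (incident G11b-3, run/shared/lean/ops/buildfix/G11b-3-DOSSIER.md). `isDeniedPremise` skips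
`[implicit_reducible]` constants before any fold, and the status is inert on theorems (Meta never unfolds `thmInfo`).
v2 form: ONE file-final, top-level `local` attribute — it goes through the synchronous scoped reducibility extension that
`getReducibilityStatusCore` reads first, so it needs no `set_option Elab.async false` (parallel elaboration stays on), also
reaches auto-realized `*.congr_simp` / structure-projection theorem constants, is never popped before export, and is not
exported. No statement or proof is changed. -/
set_option allowUnsafeReducibility true in
attribute [local implicit_reducible]
  Literature.NumberTheory.GelbartRogawski1991.UnitaryDualPair.seesawChar₁_eq_one_of_rational
  Literature.NumberTheory.GelbartRogawski1991.UnitaryDualPair.seesawChar₂_eq_one_of_rational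
  Literature.NumberTheory.GelbartRogawski1991.UnitaryDualPair.seesawRep₁_toHomUnits_mem_thetaStabilizer
  Literature.NumberTheory.GelbartRogawski1991.UnitaryDualPair.seesawRep₂_toHomUnits_mem_thetaStabilizer
  Literature.NumberTheory.GelbartRogawski1991.UnitaryDualPair.hasThetaMajorants_seesawRep₁
  Literature.NumberTheory.GelbartRogawski1991.UnitaryDualPair.hasThetaMajorants_seesawRep₂
  Literature.NumberTheory.GelbartRogawski1991.UnitaryDualPair.seesawDatum₁_thetaFun_mk
  Literature.NumberTheory.GelbartRogawski1991.UnitaryDualPair.seesawDatum₂_thetaFun_mk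
  Literature.NumberTheory.GelbartRogawski1991.UnitaryDualPair.blockDiag_mem_range
  Literature.NumberTheory.GelbartRogawski1991.UnitaryDualPair.isSeesawProduct_seesawTensor
  Literature.NumberTheory.GelbartRogawski1991.UnitaryDualPair.thetaKernelDatum_thetaFun_seesawWedge
  Literature.NumberTheory.GelbartRogawski1991.UnitaryDualPair.seesawPeriod_eq_thetaLift_mul
  Literature.NumberTheory.GelbartRogawski1991.UnitaryDualPair.seesawPeriod_wedge_eq_det
  Literature.NumberTheory.GelbartRogawski1991.UnitaryDualPair.seesawConjChar₁_eq_one_of_rational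
  Literature.NumberTheory.GelbartRogawski1991.UnitaryDualPair.seesawConjChar₂_eq_one_of_rational
  Literature.NumberTheory.GelbartRogawski1991.UnitaryDualPair.seesawConjRep₁_toHomUnits_mem_thetaStabilizer
  Literature.NumberTheory.GelbartRogawski1991.UnitaryDualPair.seesawConjRep₂_toHomUnits_mem_thetaStabilizer
  Literature.NumberTheory.GelbartRogawski1991.UnitaryDualPair.isometryConj_blockDiag_mem_range
  Literature.NumberTheory.GelbartRogawski1991.UnitaryDualPair.isSeesawProduct_seesawConjTensor
  Literature.NumberTheory.GelbartRogawski1991.UnitaryDualPair.seesawConjPeriod_eq_thetaLift_mul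
  Literature.NumberTheory.GelbartRogawski1991.UnitaryDualPair.charV₁₂.congr_simp
  Literature.NumberTheory.GelbartRogawski1991.UnitaryDualPair.char₁.congr_simp
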